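import Summits.AtomisticToContinuum.FouriersLaw.Theses.EmbeddedDrudeMourre
import Summits.AtomisticToContinuum.FouriersLaw.Theorems.EmbeddedDrudeMourreAbelOfSpectralDensity
import Summits.AtomisticToContinuum.FouriersLaw.Theorems.EmbeddedDrudeMourreGreenKuboContinuationCanonicalSpectralMeasure
import Summits.AtomisticToContinuum.FouriersLaw.Theorems.EmbeddedDrudeMourreGreenKuboContinuationFilterInvariance
import Summits.AtomisticToContinuum.FouriersLaw.Theorems.EmbeddedDrudeMourreGreenKuboContinuationOrthonormalPolySeqExists
import Summits.AtomisticToContinuum.FouriersLaw.Theorems.EmbeddedDrudeMourreGreenKuboContinuationMateNevai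
import HarnessLib

/-!
# Skeleton of line `FilterInvariance` (card `band-limited-krylov-dimerisation`, crux-ideate r2 k4)
# for the crux `EmbeddedDrudeMourre.GreenKuboContinuation` (item stmt-AtomisticToContinuum-12597)

Lead prover-line-stmt-AtomisticToContinuum-12597-c7-0 (continuation of leads a3, c6), 2026-08-16.

Rev 8 (c7, cycle 1). State inherited from c6 rev 7: S1 `stub_canonicalSpectralMeasure` (p121052), S2
`stub_filterInvariance` (p121062), S3 `stub_mateNevaiBoundedVariation` (p124037, the Máté–Nevai
bounded-variation theorem, PROVED in the tree from c6's wave-1 pieces p123251 p123402 p123434 p123543 p123549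
p123769; Literature fact `MateNevaiBoundedVariation[Even]` discharged), S5 `stub_orthonormalPolySeq_exists`
(p121304) are TREE THEOREMS (imported); the only open stub was S4 `stub_noKrylovDimerisation` (the bet).
This revision registers, next to S4, the line's abstract chain-free ENGINE as stub S6 `stub_abelOfBandLimit`
(finite even `σ`; BV Jacobi coefficients `→ 1/2` of the band-limited measure `((1-ω²)₊)²·σ` ⇒ continuous
positive density `g` on `(-1,1)` AND the Poisson–Abel limit `∫ ν/(ν²+ω²) dσ → π g(0)`), so that the whole
composition of the line can be LANDED as one `--supports` file
(`Theorems/EmbeddedDrudeMourreGreenKuboContinuationAbelOfBandLimit.lean`: S6 proved from S2 + S3 +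
`AbelOfSpectralDensity`, plus the conditional closure `greenKuboContinuation_of_noKrylovDimerisation :
S4 → crux`). After it lands, rev 9 imports it and the skeleton is again ONE sorry (S4).
Sorries here: 2 = S4 (conjecture-grade, held by the lead) + S6 (theorem-grade, proof written, landing).

## The line (card `Ideas/band-limited-krylov-dimerisation.md`, `LineGlueShape`)

Take the CANONICAL pair of the pinned anharmonic chain `P = pinnedChain ω₂ lam β γ` (Buttà–Marchioro flow
on `bmGood P` + a shift-invariant DLR state `μ_T`) and the finite even spectral measure `σ_T` of its
summed current autocorrelation, `C_T(t) = ∫ cos(ωt) dσ_T(ω)` (S1). FILTER it in frequency to the band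
`[-1, 1]`: `τ_T := ψ · σ_T`, `ψ(ω) = ((1 - ω²)₊)²`. By FILTER INVARIANCE (S2) the Poisson–Abel limit at
frequency `0` of `σ_T` exists iff that of `τ_T` does, with the same value. IF (S4, THE BET) `τ_T` has
infinite support and the Jacobi coefficients `a_n` of its orthonormal polynomials (S5) tend to `1/2`
with `Σ |a_{n+1} - a_n| < ∞`, then by the MÁTÉ–NEVAI bounded-variation theorem (S3, PROVED) `τ_T` is
absolutely continuous on `(-1, 1)` with a continuous strictly positive density `g`; the route's PROVED
support `AbelOfSpectralDensity` (stmt-12598) gives the Abel limit `π g(0) > 0` for `τ_T`, filter invariance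
moves it back to `σ_T` (these three steps are S6), and `κ := T⁻² π g(0) > 0` makes the canonical pair a
witness at `T`. The corner hypothesis of the crux is discarded (forced; cf. p117235).

## Stubs (registered; `sorry` only here)

* S4 `stub_noKrylovDimerisation` — the conjecture (card: "no theorem of this kind exists") [the bet].
* S6 `stub_abelOfBandLimit` — the abstract engine (S2 + S3 + `AbelOfSpectralDensity`) [theorem-grade;
  proof in `work/stubs/AbelOfBandLimit.lean`, landing this cycle].

## Composition

`GreenKuboContinuation_of : GreenKuboContinuation` (S1 canonical pair; S4; S5 ONPs of `τ_T`; S6; Fubini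
`integral_exp_neg_mul_cosTransform` back to the time side).
-/

noncomputable section

namespace Summit.AtomisticToContinuum.FouriersLaw.Theorems.GreenKuboContinuation.BandLimitedKrylov

open Filter Topology MeasureTheory Set Polynomial
open Literature.MathematicalPhysics.KineticTheory.HeatConduction

/-! ## S1, S2, S3, S5 — LANDED (imported): `stub_canonicalSpectralMeasure`, `stub_filterInvariance`,
`stub_mateNevaiBoundedVariation`, `stub_orthonormalPolySeq_exists` resolve to the tree theorems of the
same fully-qualified names. -/

/-! ## S4 — THE BET: no Krylov dimerisation of the band-limited canonical current spectral measure -/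

/-- **S4 `stub_noKrylovDimerisation`** (the conjecture of the card; STRONGER than the crux). For the pinned
chain (all parameters `> 0`), every dynamics `D` with carrier `bmGood`, every `T > 0`, every shift-invariant
DLR state `μ` at `T` preserved by `D`, and every finite even measure `σ` with `C_{D,μ}(t) = ∫ cos(ωt) dσ`:
the band-limited measure `τ = ((1-ω²)₊)² · σ` has infinite support, and for every orthonormal polynomial
sequence of `τ` the Jacobi coefficients `a_{n+1} = k_n/k_{n+1}` tend to `1/2` with `Σ |a_{n+2} - a_{n+1}| < ∞`
("the Krylov chain of the heat current does not dimerise"). No theorem of this kind exists for any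
interacting lattice current (card); by KMVV asymptotics and Máté–Nevai it is equivalent in strength to a
continuous strictly positive current spectral density on the whole band. -/
theorem stub_noKrylovDimerisation :
    ∀ ω₂ lam β γ : ℝ, 0 < ω₂ → 0 < lam → 0 < β → 0 < γ →
      ∀ D : InfiniteChainDynamics (pinnedChain ω₂ lam β γ),
        D.carrier = (pinnedChain ω₂ lam β γ).bmGood →
        ∀ T : ℝ, 0 < T → ∀ (μ : Measure ChainConfig) (σ : Measure ℝ),
          (pinnedChain ω₂ lam β γ).IsChainGibbsMeasure T μ → IsShiftInvariant μ →
          D.PreservesMeasure μ → IsFiniteMeasure σ → σ.map (fun ω : ℝ => -ω) = σ →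
          (∀ t : ℝ, D.currentCorrelation μ t = ∫ ω, Real.cos (ω * t) ∂σ) →
          (∀ s : Finset ℝ,
            σ.withDensity (fun ω : ℝ => ENNReal.ofReal ((max (1 - ω ^ 2) 0) ^ 2)) (↑s : Set ℝ)ᶜ ≠ 0) ∧
          ∀ p : ℕ → Polynomial ℝ,
            (∀ n, (p n).natDegree = n) → (∀ n, 0 < (p n).leadingCoeff) →
            (∀ m n, ∫ ω, (p m).eval ω * (p n).eval ω
                ∂(σ.withDensity (fun ω : ℝ => ENNReal.ofReal ((max (1 - ω ^ 2) 0) ^ 2))) =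
              if m = n then 1 else 0) →
            Tendsto (fun n => (p n).leadingCoeff / (p (n + 1)).leadingCoeff) atTop (𝓝 (1 / 2)) ∧
            Summable (fun n => |(p (n + 1)).leadingCoeff / (p (n + 2)).leadingCoeff -
              (p n).leadingCoeff / (p (n + 1)).leadingCoeff|) := by
  sorry

/-! ## S6 — the abstract engine: BV Jacobi coefficients of `ψ · σ` ⇒ Poisson–Abel limit of `σ` -/

/-- **S6 `stub_abelOfBandLimit`** (theorem-grade; proof written in `work/stubs/AbelOfBandLimit.lean` from
S2 `stub_filterInvariance`, S3 `stub_mateNevaiBoundedVariation` and the route support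
`AbelOfSpectralDensity`). For a finite even measure `σ` on `ℝ` and an orthonormal polynomial sequence `p`
of the band-limited measure `((1-ω²)₊)² · σ` with Jacobi coefficients `a_{n+1} = k_n/k_{n+1} → 1/2` of
bounded variation: `((1-ω²)₊)² · σ` has a continuous strictly positive density `g` on `(-1, 1)` and
`∫ ν/(ν²+ω²) dσ(ω) → π g(0)` as `ν ↓ 0`. -/
theorem stub_abelOfBandLimit :
    ∀ σ : Measure ℝ, IsFiniteMeasure σ → σ.map (fun ω : ℝ => -ω) = σ →
      ∀ p : ℕ → Polynomial ℝ,
        (∀ n, (p n).natDegree = n) → (∀ n, 0 < (p n).leadingCoeff) →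
        (∀ m n, ∫ ω, (p m).eval ω * (p n).eval ω
            ∂(σ.withDensity (fun ω : ℝ => ENNReal.ofReal ((max (1 - ω ^ 2) 0) ^ 2))) =
          if m = n then 1 else 0) →
        Tendsto (fun n => (p n).leadingCoeff / (p (n + 1)).leadingCoeff) atTop (𝓝 (1 / 2)) →
        Summable (fun n => |(p (n + 1)).leadingCoeff / (p (n + 2)).leadingCoeff -
          (p n).leadingCoeff / (p (n + 1)).leadingCoeff|) →
        ∃ g : ℝ → ℝ, ContinuousOn g (Set.Ioo (-1) 1) ∧ (∀ ω ∈ Set.Ioo (-1 : ℝ) 1, 0 < g ω) ∧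
          (σ.withDensity (fun ω : ℝ => ENNReal.ofReal ((max (1 - ω ^ 2) 0) ^ 2))).restrict
              (Set.Ioo (-1) 1) =
            (volume.restrict (Set.Ioo (-1) 1)).withDensity (fun ω => ENNReal.ofReal (g ω)) ∧
          Tendsto (fun ν : ℝ => ∫ ω, ν / (ν ^ 2 + ω ^ 2) ∂σ) (𝓝[>] (0 : ℝ))
            (𝓝 (Real.pi * g 0)) := by
  sorry

/-! ## Glue (minimal; the full set lands with S6 as `nkd_*`) -/

/-- `ψ ≤ 1` for `ψ(ω) = ((1 - ω²)₊)²`. -/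
theorem skel_psi_le_one (ω : ℝ) : (max (1 - ω ^ 2) 0) ^ 2 ≤ 1 := by
  have h0 : 0 ≤ max (1 - ω ^ 2) 0 := le_max_right _ _
  have h1 : max (1 - ω ^ 2) 0 ≤ 1 := max_le (by nlinarith [sq_nonneg ω]) zero_le_one
  nlinarith

/-- `ψ` vanishes off `[-1, 1]`. -/
theorem skel_psi_eq_zero_of_not_mem {ω : ℝ} (h : ω ∉ Set.Icc (-1 : ℝ) 1) :
    (max (1 - ω ^ 2) 0) ^ 2 = 0 := by
  have h1 : 1 - ω ^ 2 ≤ 0 := by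
    rcases not_and_or.1 (fun hh => h ⟨hh.1, hh.2⟩) with h' | h'
    · have h'' : ω < -1 := lt_of_not_ge h'
      nlinarith
    · have h'' : 1 < ω := lt_of_not_ge h'
      nlinarith
  simp [max_eq_right h1]

/-- Measurability of the `ℝ≥0∞`-valued density `ofReal ∘ ψ`. -/
theorem skel_measurable_ofReal_psi :
    Measurable fun ω : ℝ => ENNReal.ofReal ((max (1 - ω ^ 2) 0) ^ 2) :=
  ENNReal.measurable_ofReal.comp ((by fun_prop : Continuous fun ω : ℝ => (max (1 - ω ^ 2) 0) ^ 2).measurable)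

/-- `ψ · σ` is a finite measure (`ψ ≤ 1`). -/
theorem skel_isFiniteMeasure_bandLimit (σ : Measure ℝ) [IsFiniteMeasure σ] :
    IsFiniteMeasure (σ.withDensity fun ω : ℝ => ENNReal.ofReal ((max (1 - ω ^ 2) 0) ^ 2)) := by
  refine isFiniteMeasure_withDensity ?_
  have h : ∫⁻ ω, ENNReal.ofReal ((max (1 - ω ^ 2) 0) ^ 2) ∂σ ≤ ∫⁻ _ω, 1 ∂σ := by
    refine lintegral_mono fun ω => ?_
    calc ENNReal.ofReal ((max (1 - ω ^ 2) 0) ^ 2)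
        ≤ ENNReal.ofReal 1 := ENNReal.ofReal_le_ofReal (skel_psi_le_one ω)
      _ = 1 := ENNReal.ofReal_one
  refine ne_of_lt (lt_of_le_of_lt h ?_)
  rw [lintegral_const, one_mul]
  exact measure_lt_top σ _

/-- `ψ · σ` is carried by `[-1, 1]`. -/
theorem skel_bandLimit_compl_Icc (σ : Measure ℝ) :
    σ.withDensity (fun ω : ℝ => ENNReal.ofReal ((max (1 - ω ^ 2) 0) ^ 2)) (Set.Icc (-1 : ℝ) 1)ᶜ = 0 := by
  rw [withDensity_apply _ (measurableSet_Icc.compl)]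
  refine (lintegral_eq_zero_iff skel_measurable_ofReal_psi).2 ?_
  rw [Filter.EventuallyEq, ae_restrict_iff' (measurableSet_Icc.compl)]
  exact Eventually.of_forall fun ω hω => by simp [skel_psi_eq_zero_of_not_mem hω]

/-! ## Composition -/

/-- **The line closes the crux modulo its stubs.** S1, S5 (tree), S6 (engine) and S4 (the bet) imply
`EmbeddedDrudeMourre.GreenKuboContinuation`: the canonical pair is an Abelian Green–Kubo witness at every
`T > 0` with `κ = T⁻² π g_T(0)`, `g_T` the continuous positive density of the band-limited current spectral
measure; the corner hypothesis is not used. -/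
theorem GreenKuboContinuation_of :
    Summit.AtomisticToContinuum.FouriersLaw.Theses.EmbeddedDrudeMourre.GreenKuboContinuation := by
  unfold Summit.AtomisticToContinuum.FouriersLaw.Theses.EmbeddedDrudeMourre.GreenKuboContinuation
  intro ω₂ lam β γ hω hl hβ hγ _T₀ _hT₀ _hcorner T hT
  -- S1: the canonical pair and its even spectral measure
  obtain ⟨D, hcar, hfam⟩ := stub_canonicalSpectralMeasure ω₂ lam β γ hω hl hβ hγ
  obtain ⟨μ, σ, hG, hS, hP, hAC, hσfin, hσeven, hC⟩ := hfam T hT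
  haveI : IsFiniteMeasure σ := hσfin
  -- S4: infinite support and bounded-variation Jacobi coefficients of `ψ · σ`
  obtain ⟨hinf, hasymp⟩ := stub_noKrylovDimerisation ω₂ lam β γ hω hl hβ hγ D hcar T hT μ σ hG hS hP
    hσfin hσeven hC
  -- S5: an orthonormal polynomial sequence of `ψ · σ`
  obtain ⟨p, hdeg, hlc, horth⟩ := stub_orthonormalPolySeq_exists
    (σ.withDensity fun ω : ℝ => ENNReal.ofReal ((max (1 - ω ^ 2) 0) ^ 2)) 1
    (skel_isFiniteMeasure_bandLimit σ) (skel_bandLimit_compl_Icc σ) hinf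
  obtain ⟨hlim, hbv⟩ := hasymp p hdeg hlc horth
  -- S6: the engine, on the frequency side
  obtain ⟨g, _hgc, hgpos, _hτg, hPoissonσ⟩ := stub_abelOfBandLimit σ hσfin hσeven p hdeg hlc horth hlim hbv
  -- back to the time side for the physical autocorrelation
  have hAbelσ : Tendsto (fun ν : ℝ => ∫ t in Ioi (0 : ℝ), Real.exp (-(ν * t)) *
      D.currentCorrelation μ t) (𝓝[>] (0 : ℝ)) (𝓝 (Real.pi * g 0)) := by
    refine hPoissonσ.congr' ?_
    filter_upwards [self_mem_nhdsWithin] with ν hν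
    have hfun : (fun t : ℝ => Real.exp (-(ν * t)) * D.currentCorrelation μ t) =
        fun t : ℝ => Real.exp (-(ν * t)) * ∫ ω, Real.cos (ω * t) ∂σ := by
      funext t; rw [hC t]
    rw [hfun]
    exact (Summit.AtomisticToContinuum.FouriersLaw.Theorems.AbelOfSpectralDensity.integral_exp_neg_mul_cosTransform
      σ hν).symm
  -- the witness
  have hg00 : 0 < g 0 := hgpos 0 ⟨by norm_num, by norm_num⟩
  refine ⟨μ, D, (T ^ 2)⁻¹ * (Real.pi * g 0), hG, hP, hAC, by positivity, ?_⟩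
  exact hAbelσ.const_mul ((T ^ 2)⁻¹)

end Summit.AtomisticToContinuum.FouriersLaw.Theorems.GreenKuboContinuation.BandLimitedKrylov

end
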